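import Summits.QuantumFields.YangMills.Theorems.BalabanUVNodesN08AlphaAbelianCone

/-!
# Route «BalabanUVNodes», Track-A DAG node N08 = [Balaban1985UV3] — (α) clause, the in-edge sentence (b11‴) CONSTRUCTED, part 5a:
# BLENDED ONE-FORMS — the curl of `Σ_j (ω_j ∘ π)·P_j`, exact locality, the two-level bound, and the sharp cone budget

Cell `pub-ymgap`, seat `pub-ymgap-dag-n08-d` gen 5, file F5a (over F2c `…N08AlphaAbelianCone`).  `bears_on: R4∕N08`; filed `--supports stmt-QuantumFields-19910
--as helper`.  Sorry-free, standard axioms.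

CONTENTS ([folklore] algebra on `ℤ^d`; `π` is any map to an index set — in F5b the projection to the torus): for `A = blend k π ω P : (x, μ) ↦ Σ_{j<k} ω_j(πx)·P_j(x, μ)`,
* `curl_blend`: `curl A(x; μ,ν) = Σ_j [ω_j(πx)·curl P_j(x; μ,ν) + (ω_j(π(x+e_μ)) − ω_j(πx))·P_j(x+e_μ, ν) − (ω_j(π(x+e_ν)) − ω_j(πx))·P_j(x+e_ν, μ)]`;
* ★ `curl_blend_eq_of_local`: where one weight is `1` and the others `0` at the three points `πx, π(x+e_μ), π(x+e_ν)`, `curl A = curl P_{j₀}`;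
* ★ `abs_curl_blend_le`: where only the weights `j₀, j₀+1` are non-zero at the three points, the weights are non-negative with total `≤ 1` and vary by
  `≤ δ` between the points, `|curl A| ≤ c + 2δ(m_{j₀} + m_{j₀+1})` (`c` bounding the two `|curl P_j|`, `m_j` bounding `|P_j|`);
* `coneTame_of_curl_bound_sharp`: F2c's tameness with the budget at the top level READ, `d·L²·(L^{j−1})²·m·‖X‖ < log 2`.
HONEST FRAMING: kernel bookkeeping for TEST configurations; nothing of [B10] ∕ [7] ∕ [4]'s estimates asserted; count-neutral; NOT a discharge of N08.
-/

noncomputable section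

namespace Summit.QuantumFields.YangMills.Theorems.BalabanUVNodesN08AlphaBlend

open scoped BigOperators
open Literature.MathematicalPhysics.QuantumFieldTheory.Balaban1983to89
open B7Prop1Explicit
open B7Prop1Local (InBox bondHi)
open Summit.QuantumFields.YangMills.Theorems.BalabanUVNodesN08AlphaAbelianLift
open Summit.QuantumFields.YangMills.Theorems.BalabanUVNodesN08AlphaAbelianAverage
open Summit.QuantumFields.YangMills.Theorems.BalabanUVNodesN08AlphaAbelianWindow
open Summit.QuantumFields.YangMills.Theorems.BalabanUVNodesN08AlphaAbelianCone

variable {d : ℕ} {T : Type*}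

/-! ## §1 The blend and its curl -/

/-- **THE BLENDED ONE-FORM** `(x, μ) ↦ Σ_{j<k} ω_j(πx)·P_j(x, μ)`. [folklore] -/
def blend (k : ℕ) (π : Site d → T) (ω : ℕ → T → ℝ) (P : ℕ → Site d → Fin d → ℝ) : Site d → Fin d → ℝ :=
  fun x μ => ∑ j ∈ Finset.range k, ω j (π x) * P j x μ

/-- **THE CURL OF THE BLEND** (discrete product rule). [folklore] -/
theorem curl_blend (k : ℕ) (π : Site d → T) (ω : ℕ → T → ℝ) (P : ℕ → Site d → Fin d → ℝ) (x : Site d) (μ ν : Fin d) :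
    curl (blend k π ω P) x μ ν = ∑ j ∈ Finset.range k,
      (ω j (π x) * curl (P j) x μ ν + (ω j (π (x + e μ)) - ω j (π x)) * P j (x + e μ) ν - (ω j (π (x + e ν)) - ω j (π x)) * P j (x + e ν) μ) := by
  simp only [curl, blend, ← Finset.sum_add_distrib, ← Finset.sum_sub_distrib]
  exact Finset.sum_congr rfl fun j _ => by ring

/-- **★ EXACT LOCALITY**: if at the three points `πx, π(x+e_μ), π(x+e_ν)` the weight `j₀ < k` equals `1` and all other weights vanish, then
`curl A(x; μ,ν) = curl P_{j₀}(x; μ,ν)`. [folklore] -/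
theorem curl_blend_eq_of_local {k : ℕ} (π : Site d → T) (ω : ℕ → T → ℝ) (P : ℕ → Site d → Fin d → ℝ) (x : Site d) (μ ν : Fin d) {j₀ : ℕ}
    (hj₀ : j₀ < k) (h1 : ω j₀ (π x) = 1 ∧ ω j₀ (π (x + e μ)) = 1 ∧ ω j₀ (π (x + e ν)) = 1)
    (h0 : ∀ j, j < k → j ≠ j₀ → ω j (π x) = 0 ∧ ω j (π (x + e μ)) = 0 ∧ ω j (π (x + e ν)) = 0) :
    curl (blend k π ω P) x μ ν = curl (P j₀) x μ ν := by
  rw [curl_blend, Finset.sum_eq_single j₀]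
  · rw [h1.1, h1.2.1, h1.2.2]; ring
  · intro j hj hne
    rw [Finset.mem_range] at hj
    obtain ⟨a, b, c⟩ := h0 j hj hne
    rw [a, b, c]; ring
  · intro hj; exact absurd (Finset.mem_range.2 hj₀) hj

/-- **★ THE TWO-LEVEL BOUND**: if only the weights `j₀, j₀ + 1` are non-zero at the three points, all weights are non-negative with `Σ_j ω_j(πx) ≤ 1`, the two
active weights vary by at most `δ` from `πx` to `π(x+e_μ)` and to `π(x+e_ν)`, `|curl P_j| ≤ c` and `|P_j| ≤ m_j` (`m_j ≥ 0`) for the two active `j`, then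
`|curl A(x; μ,ν)| ≤ c + 2δ(m_{j₀} + m_{j₀+1})`. [folklore] -/
theorem abs_curl_blend_le {k : ℕ} (π : Site d → T) (ω : ℕ → T → ℝ) (P : ℕ → Site d → Fin d → ℝ) (x : Site d) (μ ν : Fin d) (j₀ : ℕ)
    {c δ : ℝ} {m : ℕ → ℝ} (hc0 : 0 ≤ c) (hδ0 : 0 ≤ δ) (hm0 : ∀ j, 0 ≤ m j)
    (h0 : ∀ j, j < k → j ≠ j₀ → j ≠ j₀ + 1 → ω j (π x) = 0 ∧ ω j (π (x + e μ)) = 0 ∧ ω j (π (x + e ν)) = 0)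
    (hnn : ∀ j, 0 ≤ ω j (π x)) (hsum : ∑ j ∈ Finset.range k, ω j (π x) ≤ 1)
    (hδ : ∀ j, (j = j₀ ∨ j = j₀ + 1) → |ω j (π (x + e μ)) - ω j (π x)| ≤ δ ∧ |ω j (π (x + e ν)) - ω j (π x)| ≤ δ)
    (hc : ∀ j, (j = j₀ ∨ j = j₀ + 1) → |curl (P j) x μ ν| ≤ c)
    (hm : ∀ j, (j = j₀ ∨ j = j₀ + 1) → |P j (x + e μ) ν| ≤ m j ∧ |P j (x + e ν) μ| ≤ m j) :
    |curl (blend k π ω P) x μ ν| ≤ c + 2 * δ * (m j₀ + m (j₀ + 1)) := by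
  rw [curl_blend]
  -- per-term bound
  have hterm : ∀ j ∈ Finset.range k,
      |ω j (π x) * curl (P j) x μ ν + (ω j (π (x + e μ)) - ω j (π x)) * P j (x + e μ) ν - (ω j (π (x + e ν)) - ω j (π x)) * P j (x + e ν) μ| ≤
        ω j (π x) * c + ((if j = j₀ then 2 * δ * m j₀ else 0) + (if j = j₀ + 1 then 2 * δ * m (j₀ + 1) else 0)) := by
    intro j hj
    rw [Finset.mem_range] at hj
    by_cases hact : j = j₀ ∨ j = j₀ + 1
    · obtain ⟨hδ1, hδ2⟩ := hδ j hact
      obtain ⟨hm1, hm2⟩ := hm j hact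
      have hcj := hc j hact
      have hind : ((if j = j₀ then 2 * δ * m j₀ else 0) + (if j = j₀ + 1 then 2 * δ * m (j₀ + 1) else 0)) = 2 * δ * m j := by
        rcases hact with rfl | rfl
        · rw [if_pos rfl, if_neg (by omega), add_zero]
        · rw [if_neg (by omega), if_pos rfl, zero_add]
      rw [hind]
      calc |ω j (π x) * curl (P j) x μ ν + (ω j (π (x + e μ)) - ω j (π x)) * P j (x + e μ) ν - (ω j (π (x + e ν)) - ω j (π x)) * P j (x + e ν) μ|
          ≤ |ω j (π x) * curl (P j) x μ ν| + |(ω j (π (x + e μ)) - ω j (π x)) * P j (x + e μ) ν| + |(ω j (π (x + e ν)) - ω j (π x)) * P j (x + e ν) μ| := by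
            rw [sub_eq_add_neg]
            refine (abs_add_three _ _ _).trans ?_
            rw [abs_neg]
        _ ≤ ω j (π x) * c + δ * m j + δ * m j := by
            rw [abs_mul, abs_mul, abs_mul, abs_of_nonneg (hnn j)]
            exact add_le_add (add_le_add (mul_le_mul_of_nonneg_left hcj (hnn j)) (mul_le_mul hδ1 hm1 (abs_nonneg _) hδ0))
              (mul_le_mul hδ2 hm2 (abs_nonneg _) hδ0)
        _ = ω j (π x) * c + 2 * δ * m j := by ring
    · rw [not_or] at hact
      obtain ⟨a, b, c'⟩ := h0 j hj hact.1 hact.2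
      rw [a, b, c', if_neg hact.1, if_neg hact.2]
      simp
  refine (Finset.abs_sum_le_sum_abs _ _).trans ((Finset.sum_le_sum hterm).trans ?_)
  rw [Finset.sum_add_distrib, Finset.sum_add_distrib, ← Finset.sum_mul, Finset.sum_ite_eq', Finset.sum_ite_eq']
  have h1 : (∑ j ∈ Finset.range k, ω j (π x)) * c ≤ c := by
    calc (∑ j ∈ Finset.range k, ω j (π x)) * c ≤ 1 * c := mul_le_mul_of_nonneg_right hsum hc0
      _ = c := one_mul c
  have h2 : (if j₀ ∈ Finset.range k then 2 * δ * m j₀ else 0) ≤ 2 * δ * m j₀ := by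
    split_ifs
    · exact le_rfl
    · have := hm0 j₀; positivity
  have h3 : (if j₀ + 1 ∈ Finset.range k then 2 * δ * m (j₀ + 1) else 0) ≤ 2 * δ * m (j₀ + 1) := by
    split_ifs
    · exact le_rfl
    · have := hm0 (j₀ + 1); positivity
  linarith

/-! ## §2 The cone budget at the top level read -/

variable (L : ℕ) {𝔸 : Type*} [NormedRing 𝔸]

/-- **TAMENESS OF THE CONE, SHARP BUDGET**: as F2c's `coneTame_of_curl_bound`, with the level budget of the TOP level actually read by (43),
`d·L²·(L^{j−1})²·m·‖X‖ < log 2`. [cite: Balaban1985Averaging, (42)–(43) pp.23–24 + (47)–(49) p.25] -/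
theorem coneTame_of_curl_bound_sharp (hL : 1 ≤ L) (X : 𝔸) (a : Site d → Fin d → ℝ) {m : ℝ} (hm : 0 ≤ m) :
    ∀ (j : ℕ) (z : Site d) (κ : Fin d), (∀ x, ConeBox L j z κ x → ∀ μ ν, |curl a x μ ν| ≤ m) →
      (d : ℝ) * (L : ℝ) ^ 2 * (((L : ℝ) ^ (j - 1)) ^ 2 * m) * ‖X‖ < Real.log 2 → ConeTame L X a j z κ
  | 0, _, _, _, _ => trivial
  | j + 1, z, κ, hbox, hbud => by
    have hL1 : (1 : ℝ) ≤ L := by exact_mod_cast hL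
    rw [Nat.add_sub_cancel] at hbud
    have hbudj : (d : ℝ) * (L : ℝ) ^ 2 * (((L : ℝ) ^ (j - 1)) ^ 2 * m) * ‖X‖ < Real.log 2 := by
      refine lt_of_le_of_lt ?_ hbud
      have : ((L : ℝ) ^ (j - 1)) ^ 2 ≤ ((L : ℝ) ^ j) ^ 2 := by gcongr; exacts [Nat.sub_le j 1]
      have hd : (0 : ℝ) ≤ d := Nat.cast_nonneg d
      have : (d : ℝ) * (L : ℝ) ^ 2 * (((L : ℝ) ^ (j - 1)) ^ 2 * m) ≤ (d : ℝ) * (L : ℝ) ^ 2 * (((L : ℝ) ^ j) ^ 2 * m) := by gcongr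
      exact mul_le_mul_of_nonneg_right this (norm_nonneg X)
    refine ⟨fun r => ?_, fun y μ' hy hye => ?_⟩
    · have hcurl : ∀ (x' : Site d) (ν' : Fin d), InBox ((L : ℤ) • z) (bondHi L ((L : ℤ) • z) κ) x' →
          InBox ((L : ℤ) • z) (bondHi L ((L : ℤ) • z) κ) (x' + e ν' + e κ) → |curl (linAvgIter L a j) x' ν' κ| ≤ ((L : ℝ) ^ j) ^ 2 * m :=
        fun x' ν' hx' hx'e => abs_curl_linAvgIter_le L hL ν' κ hm j x' fun x hx =>
          hbox x (inWindow_of_subPlaq L hL j z κ hx' hx'e hx) ν' κ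
      have hflux := abs_wflux_le L hL (linAvgIter L a j) ((L : ℤ) • z) κ r (by positivity) hcurl
      calc |wflux L (linAvgIter L a j) ((L : ℤ) • z) κ (boxVec L r)| * ‖X‖ ≤ (d * (L : ℝ) ^ 2 * (((L : ℝ) ^ j) ^ 2 * m)) * ‖X‖ :=
            mul_le_mul_of_nonneg_right hflux (norm_nonneg X)
        _ < Real.log 2 := hbud
    · exact coneTame_of_curl_bound_sharp hL X a hm j y μ' (fun x hx => hbox x (coneBox_of_subBond L hL j z κ hy hye hx)) hbudj

end Summit.QuantumFields.YangMills.Theorems.BalabanUVNodesN08AlphaBlend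

end
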